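import Summits.Langlands.Langlands.Theses.PhantomRMYoshida
import Literature.NumberTheory.Automorphic.LocalComponentBJGenericProofs
import Literature.NumberTheory.Automorphic.LocalLanglandsGLOne
import Literature.NumberTheory.Automorphic.LocalConstantsUniquenessProofs
import Summits.Langlands.Langlands.Theorems.DyadicOddResidueSectorComplementStubEpsTransport
import Summits.Langlands.Langlands.Theorems.DyadicOddResidueSectorComplementStubEpsArtinEq
import HarnessLib

/-!
# BIRTH SKELETON — piece U `PinnedRecRigidity` of the split of `PhantomRMYoshida.PhantomRMJunction`
(stmt-Langlands-13643). Crux-strategist planner-cstrat-stmt-Langlands-13643-r1-0, 2026-08-17.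

`U := ∀ K (Rec Rec' : ReciprocityData K) v n πv ψ, ψ continuous non-trivial → πv generic for ψ →
 (Rec.llc v).recGL n [πv] = (Rec'.llc v).recGL n [πv]` — RIGIDITY OF PINNED RECIPROCITY DATA ON GENERIC CLASSES
(Henniart 1993 Thm 1.1 on supercuspidals; Jacquet–Langlands / JPSS 1983 §8 / Henniart 2002 Thm 1.7 on generic
non-supercuspidal classes). This is VERBATIM the local content of the registered line
`Cruxes/SectorComplement/Lines/Sketch_18745_r1_k1.lean` (lead prover-line-stmt-Langlands-18745-0, idea
`reciprocity-rigidity`), whose §1–§2 are reproduced here with attribution so that the piece has its own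
registered skeleton. Of that line's local stubs, S1 `stub_isLocalLanglandsGL_of_eps_artin_eq` (ε-transport of
the six clauses, Deligne uniqueness) and S2 `stub_llc_eps_artin_eq` (the pins identify the ε-systems' Artin
DATA) are LANDED (p145120, p144848: `Theorems/DyadicOddResidueSectorComplementStubEps{Transport,ArtinEq}.lean`,
imported by name); the stubs of THIS skeleton are S6 `stub_localLanglands_gl` (T0 named fact: Harris–Taylor
Thm A + Henniart 1993) and S5 `stub_recGL_eq_of_isGeneric_of_not_isSupercuspidal` (the open local theorem in
rank ≥ 2); ranks 0/1 and the supercuspidal classes are PROVED from them; composition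
`pinnedRecRigidity_text_of_stubs` (sorry-free outside the two stubs; the by-name `PinnedRecRigidity_proof`
is appended once the split has written the child decl).
-/

noncomputable section

set_option linter.dupNamespace false

open scoped MatrixGroups NumberField
open NumberField IsDedekindDomain Filter MeasureTheory
open Literature.NumberTheory.Automorphic Literature.NumberTheory.GaloisRepresentations
open Summit.Langlands
open Summit.Langlands.Langlands.Theorems.ReciprocityRigidity

namespace Summit.Langlands.Langlands.Cruxes.PhantomRMJunction.BirthU

/-! ## §1 Local stubs: the pins identify the normalising data -/

section Local

variable {F : Type} [Field F] [ValuativeRel F] [TopologicalSpace F] [IsNonarchimedeanLocalField F]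

/-! Stub S1 `stub_isLocalLanglandsGL_of_eps_artin_eq` (ε-transport of the six-clause property) —
LANDED p145120 (`Theorems/DyadicOddResidueSectorComplementStubEpsTransport.lean`), imported by name. -/

/-- Transport of the six-clause property along an equality of local Artin data. [folklore] -/
theorem isLocalLanglandsGL_of_artin_eq
    {hmul : IsFrobPow.mul (F := F)} {huniq : IsFrobPow.unique (F := F)}
    {hn : absInertia_normal F} {hex : exists_isFrobPow (F := F)}
    {hns : WeilGroup.exists_subgroup_le_inertia_isOpen_of_continuous (F := F)}
    {d d' : LocalArtinData F} (hd : d = d') {𝓔 : LocalEpsilonSystem F}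
    {rec : ∀ n : ℕ, IrrClass (GL (Fin n) F) → Quotient (frobSemisimpleWDSetoid F n)}
    (h : IsLocalLanglandsGL F hmul huniq hn hex hns d' 𝓔 rec) :
    IsLocalLanglandsGL F hmul huniq hn hex hns d 𝓔 rec := by
  subst hd
  exact h

end Local

section Pins

variable {K : Type} [Field K] [NumberField K]

/-- **The pins identify the local Artin DATA** (structure equality, not only the homomorphism):
the non-`artin` fields of `LocalArtinData` are propositions. [folklore] -/
theorem llc_artin_eq (Rec Rec' : ReciprocityData K) (v : HeightOneSpectrum (𝓞 K)) :
    (Rec.llc v).artin = (Rec'.llc v).artin :=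
  localArtinData_eq_of_artin_eq (Rec.artin_eq Rec' v)

/-! Stub S2 `stub_llc_eps_artin_eq` (the pins identify the ε-Artin data) — LANDED p144848
(`Theorems/DyadicOddResidueSectorComplementStubEpsArtinEq.lean`), imported by name. -/

/-- The six-clause property of `Rec'.llc v`, re-read against the normalising pair of `Rec.llc v`
(S2 + S1 + `llc_artin_eq`; the threaded `LocalGaloisGroup` facts are propositions, so the two
data's copies are definitionally equal). [folklore] -/
theorem isLocalLanglandsGL_transport (Rec Rec' : ReciprocityData K) (v : HeightOneSpectrum (𝓞 K)) :
    IsLocalLanglandsGL (v.adicCompletion K) (Rec.llc v).hmul (Rec.llc v).huniq (Rec.llc v).hn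
      (Rec.llc v).hex (Rec.llc v).hns (Rec.llc v).artin (Rec.llc v).eps (Rec'.llc v).recGL :=
  stub_isLocalLanglandsGL_of_eps_artin_eq (stub_llc_eps_artin_eq Rec Rec' v)
    (isLocalLanglandsGL_of_artin_eq (llc_artin_eq Rec Rec' v) (Rec'.llc v).isLocalLanglands)

end Pins

/-! ## §2 The named fact and the supercuspidal / rank ≤ 1 classes -/

/-- **Stub S6 (T0 LITERATURE DEBT, never delegated): the local Langlands correspondence for
`GL_n` with Henniart's uniqueness on supercuspidals holds for every non-archimedean local field and
every normalising pair** — the tree's named fact `localLanglands_gl` (Harris–Taylor 2001 Thm A;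
Henniart 2000 Thm 1.2; uniqueness Henniart 1993 Thm 1.1).
[cite: HarrisTaylorAMS2001, Thm. A] [cite: Henniarts1993, Thm 1.1] -/
theorem stub_localLanglands_gl :
    ∀ (F : Type) [Field F] [ValuativeRel F] [TopologicalSpace F] [IsNonarchimedeanLocalField F]
      (hmul : @IsFrobPow.mul F _ _ _ _) (huniq : @IsFrobPow.unique F _ _ _ _)
      (hn : absInertia_normal F) (hex : @exists_isFrobPow F _ _ _ _)
      (hns : @WeilGroup.exists_subgroup_le_inertia_isOpen_of_continuous F _ _ _ _)
      (d : LocalArtinData F) (𝓔 : LocalEpsilonSystem F) (hd : 𝓔.artin F = d),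
      localLanglands_gl F hmul huniq hn hex hns d 𝓔 hd := by
  sorry

section Classes

variable {K : Type} [Field K] [NumberField K]

/-- **Rigidity on supercuspidal classes** (Henniart 1993, Thm 1.1, through the named fact S6 and
the transport of §1). [cite: Henniarts1993, Thm 1.1] -/
theorem recGL_eq_of_isSupercuspidal (Rec Rec' : ReciprocityData K) (v : HeightOneSpectrum (𝓞 K))
    {n : ℕ} (c : IrrClass (GL (Fin n) (v.adicCompletion K))) (hc : c.IsSupercuspidal) :
    (Rec.llc v).recGL n c = (Rec'.llc v).recGL n c :=
  IsLocalLanglandsGL.unique_of_isSupercuspidal (v.adicCompletion K) _ _ _ _ _ (Rec.llc v).eps_artin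
    (stub_localLanglands_gl _ _ _ _ _ _ _ _ (Rec.llc v).eps_artin) (Rec.llc v).isLocalLanglands
    (isLocalLanglandsGL_transport Rec Rec' v) c hc

/-- **Rigidity in rank 0** (both sides are singletons). [folklore] -/
theorem recGL_eq_zero (Rec Rec' : ReciprocityData K) (v : HeightOneSpectrum (𝓞 K))
    (c : IrrClass (GL (Fin 0) (v.adicCompletion K))) :
    (Rec.llc v).recGL 0 c = (Rec'.llc v).recGL 0 c :=
  Subsingleton.elim _ _

/-- **Rigidity in rank 1**: `rec₁` of ANY local Langlands datum is the reciprocity map of local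
class field theory for its Artin datum (`IsLocalLanglandsGL.rec_one_eq_recGLOne`), and the two
Artin data coincide by the pin. [cite: HarrisTaylorAMS2001, Thm. A] -/
theorem recGL_eq_one (Rec Rec' : ReciprocityData K) (v : HeightOneSpectrum (𝓞 K))
    (c : IrrClass (GL (Fin 1) (v.adicCompletion K))) :
    (Rec.llc v).recGL 1 c = (Rec'.llc v).recGL 1 c := by
  rw [(Rec.llc v).isLocalLanglands.rec_one_eq_recGLOne,
    (Rec'.llc v).isLocalLanglands.rec_one_eq_recGLOne, llc_artin_eq Rec Rec' v]

/-- **Stub S5 (LEAD): rigidity on GENERIC, NON-SUPERCUSPIDAL classes of rank `n ≥ 2`.**  As typed,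
`IsLocalLanglandsGL` constrains such classes through `L`/`ε` of pairs against generic
representations of LOWER rank (`lFactor_pairs`, `epsilon_pairs`, `1 ≤ m < n`), twists and central
characters; the claim is the Galois-side recovery of a non-irreducible Frobenius-semisimple
parameter from these data (rank 2: `L(s, π × χ)`-probes over all quasi-characters `χ` plus the
Jacquet–Langlands criterion "`L(s, π × χ) = 1 ∀ χ` ⇒ supercuspidal"; rank ≥ 3: JPSS 1983 §8 /
Bernstein–Zelevinsky).  [cite: JacquetPiatetskiShapiroShalika1983, Thm 2.7, §8]
[cite: HarrisTaylorAMS2001, Thm. A] -/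
theorem stub_recGL_eq_of_isGeneric_of_not_isSupercuspidal
    (K : Type) [Field K] [NumberField K] (Rec Rec' : ReciprocityData K) (v : HeightOneSpectrum (𝓞 K))
    (n : ℕ) (hn : 2 ≤ n) (πv : SmoothIrrep (GL (Fin n) (v.adicCompletion K)))
    (ψ : AddChar (v.adicCompletion K) Circle) (hψ : ψ.IsContinuousNontrivial)
    (hg : IsGeneric πv.ρ ψ) (hnsc : ¬ (IrrClass.mk πv).IsSupercuspidal) :
    (Rec.llc v).recGL n (IrrClass.mk πv) = (Rec'.llc v).recGL n (IrrClass.mk πv) := by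
  sorry

/-- **R_gen from the stubs**: rigidity on every generic class of every completion, every rank. -/
theorem recRigidityGeneric_of_stubs (Rec Rec' : ReciprocityData K) (v : HeightOneSpectrum (𝓞 K))
    (n : ℕ) (πv : SmoothIrrep (GL (Fin n) (v.adicCompletion K)))
    (ψ : AddChar (v.adicCompletion K) Circle) (hψ : ψ.IsContinuousNontrivial)
    (hg : IsGeneric πv.ρ ψ) :
    (Rec.llc v).recGL n (IrrClass.mk πv) = (Rec'.llc v).recGL n (IrrClass.mk πv) := by
  by_cases hsc : (IrrClass.mk πv).IsSupercuspidal
  · exact recGL_eq_of_isSupercuspidal Rec Rec' v _ hsc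
  rcases Nat.lt_or_ge n 2 with hn | hn
  · interval_cases n
    · exact recGL_eq_zero Rec Rec' v _
    · exact recGL_eq_one Rec Rec' v _
  · exact stub_recGL_eq_of_isGeneric_of_not_isSupercuspidal K Rec Rec' v n hn πv ψ hψ hg hsc


end Classes

/-! ## §3 The piece -/

/-- **U from the stubs**, concluding the TEXT of the piece (= the child `PhantomRMYoshida.PinnedRecRigidity`
once the split is installed, definitionally). -/
theorem pinnedRecRigidity_text_of_stubs :
    ∀ (K : Type) [Field K] [NumberField K] (Rec Rec' : Summit.Langlands.ReciprocityData K) (v : IsDedekindDomain.HeightOneSpectrum (NumberField.RingOfIntegers K)) (n : ℕ) (πv : Literature.NumberTheory.Automorphic.SmoothIrrep (GL (Fin n) (v.adicCompletion K))) (ψ : AddChar (v.adicCompletion K) Circle), ψ.IsContinuousNontrivial → Literature.NumberTheory.Automorphic.IsGeneric πv.ρ ψ → (Rec.llc v).recGL n (Literature.NumberTheory.Automorphic.IrrClass.mk πv) = (Rec'.llc v).recGL n (Literature.NumberTheory.Automorphic.IrrClass.mk πv) :=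
  fun K _ _ Rec Rec' v n πv ψ hψ hg ↦ recRigidityGeneric_of_stubs Rec Rec' v n πv ψ hψ hg

end Summit.Langlands.Langlands.Cruxes.PhantomRMJunction.BirthU

end
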